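import Mathlib.Analysis.Convex.Integral
import Mathlib.Analysis.SpecialFunctions.Log.NegMulLog
import HarnessLib

/-!
# The entropy of a probability density is at most the logarithm of the total mass
# (Jensen / Gibbs' inequality; Topping 2006, §8.1 (8.1.14) and §8.3 (8.3.7))

For a finite nonzero measure `μ` and a density `σ ≥ 0` with `∫ σ dμ = 1`,

  `∫ -σ log σ dμ ≤ log μ(univ)`,

by Jensen's inequality for the concave function `G(y) = -y log y` (Mathlib's `Real.negMulLog`,
`Real.concaveOn_negMulLog`, `ConcaveOn.le_map_average`): `⨍ G(σ) dμ ≤ G(⨍ σ dμ) = G(1/μ(univ))`.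
This is the step "`∫ G(σ) dμ ≤ G(∫ σ dμ)` … `= ln (∫ dμ)`" in the proof of Topping's Lemma 8.3.5
(Term 3, (8.3.7)) and of Lemma 8.1.8 ((8.1.14)), isolated as a measure-theoretic lemma (there
`dμ = (4πλr²)^{-n/2} dV` restricted to a geodesic ball and `σ = φ²`). Equivalently: the relative
entropy of the probability measure `σ μ` with respect to the normalised `μ` is non-negative
(Gibbs' inequality).

## References

* P. Topping, *Lectures on the Ricci flow*, LMS Lecture Note Series 325, CUP 2006, §8.1, proof
  of Lemma 8.1.8, (8.1.14); §8.3, proof of Lemma 8.3.5, Term 3, (8.3.7). [Topping2006]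
-/

noncomputable section

open MeasureTheory Set Real

namespace Literature.MeasureTheory.Jensen

variable {α : Type*} [MeasurableSpace α] {μ : Measure α}

/-- **Entropy bound by the logarithm of the mass** (Jensen for `-y log y`; Topping 2006, proof
of Lemma 8.3.5, Term 3: "Because `G` is concave, we may apply Jensen's inequality
`∫ G(σ) dμ ≤ G(∫ σ dμ)` … this tells us that `∫ G(σ) dμ ≤ (∫ dμ) G(1/∫ dμ) = ln (∫ dμ)`").
For a finite nonzero measure `μ`, an a.e. non-negative integrable `σ` with `∫ σ dμ = 1` and
`-σ log σ` integrable: `∫ -σ log σ dμ ≤ log μ(univ)`. [cite: Topping2006, §8.3, proof of Lemma 8.3.5, (8.3.7)] -/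
theorem integral_negMulLog_le_log_measureReal_univ [IsFiniteMeasure μ] [NeZero μ] {σ : α → ℝ}
    (hσ : 0 ≤ᵐ[μ] σ) (hσi : Integrable σ μ) (hσ1 : ∫ x, σ x ∂μ = 1)
    (hGi : Integrable (fun x ↦ negMulLog (σ x)) μ) :
    ∫ x, negMulLog (σ x) ∂μ ≤ Real.log (μ.real univ) := by
  have hm : 0 < μ.real univ := by
    rw [measureReal_def]
    exact ENNReal.toReal_pos (NeZero.ne _) (measure_ne_top μ univ)
  have hmem : ∀ᵐ x ∂μ, σ x ∈ Ici (0 : ℝ) := by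
    filter_upwards [hσ] with x hx using hx
  have hJ := concaveOn_negMulLog.le_map_average continuous_negMulLog.continuousOn isClosed_Ici
    hmem hσi hGi
  rw [average_eq, average_eq, hσ1, smul_eq_mul, smul_eq_mul, mul_one, negMulLog,
    Real.log_inv] at hJ
  -- `hJ : (μ.real univ)⁻¹ * ∫ negMulLog σ ≤ -(μ.real univ)⁻¹ * -log (μ.real univ)`
  have hJ' : (μ.real univ)⁻¹ * ∫ x, negMulLog (σ x) ∂μ ≤ (μ.real univ)⁻¹ * Real.log (μ.real univ) := by
    linarith
  exact le_of_mul_le_mul_left hJ' (inv_pos.2 hm)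

/-- The same bound for a density supported in a set `B` of finite positive measure, with the
integrals over `B` (apply the previous lemma to `μ.restrict B`): if `σ ≥ 0` a.e. on `B`,
`∫_B σ dμ = 1`, then `∫_B -σ log σ dμ ≤ log μ(B)` (Topping 2006, (8.3.7): `dμ` supported on
the ball `B(p, r)`). [cite: Topping2006, §8.3, proof of Lemma 8.3.5, (8.3.7)] -/
theorem setIntegral_negMulLog_le_log_measureReal {B : Set α} (hB0 : μ B ≠ 0) (hBt : μ B ≠ ⊤)
    {σ : α → ℝ} (hσ : 0 ≤ᵐ[μ.restrict B] σ) (hσi : IntegrableOn σ B μ)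
    (hσ1 : ∫ x in B, σ x ∂μ = 1) (hGi : IntegrableOn (fun x ↦ negMulLog (σ x)) B μ) :
    ∫ x in B, negMulLog (σ x) ∂μ ≤ Real.log (μ.real B) := by
  haveI : IsFiniteMeasure (μ.restrict B) := ⟨by rwa [Measure.restrict_apply_univ, lt_top_iff_ne_top]⟩
  haveI : NeZero (μ.restrict B) := ⟨by rwa [Ne, Measure.restrict_eq_zero]⟩
  have h := integral_negMulLog_le_log_measureReal_univ (μ := μ.restrict B) hσ hσi hσ1 hGi
  rwa [measureReal_restrict_apply_univ] at h

end Literature.MeasureTheory.Jensen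

end
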